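import Mathlib.Tactic
import Mathlib.Data.Nat.Dist
import HarnessLib

/-!
# (BG∞) ∕ `hsupp⁺` — (G7-T)-lattice, FILE T1 OF UV3-NODE §116.4: THE PROPORTIONAL RADIAL PROJECTION OF THE DISCRETE SQUARE `{0..n}²`
# — depth `k = min(i, j, n−i, n−j)`, the ring-`k` ↦ ring-`0` map `t ↦ ⌊n(t−k)∕(n−2k)⌋` coordinatewise (corners to corners), and the DISTORTION LAW
# `(n∕2 − max depth)·|Δ projection|₁ ≤ n` for lattice neighbours — the factor the cone's depth parameter `1 − k∕(n∕2)` cancels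

Cell `ym3-torus` (YM ladder rung R3 = continuum `SU(2)` Yang–Mills on the three-torus at fixed lattice data — a RUNG: NOT d = 4, NOT infinite volume, NOT a mass gap,
NOT Clay).  Width seat «width 5» `ym3-torus-px5` (gen 24), FREE px helper on crux `stmt-QuantumFields-20520` (`…Theses.UnitScaleTilt.FluctuationComparisonRegPrIntL`);
`--kind proof --supports stmt-QuantumFields-20520 --as helper`, count-neutral, DEFINITION-FREE (0 `def`, 0 `instance`, 0 `notation`, 0 `sorry`; default heartbeats;
BINDER STYLE per desk RULING №127: the depth and projection are exported as ∃-witnesses with their defining equation and laws as conjuncts).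

WHY (architect-lineage RULING «(BG∞) PLAN OF RECORD = UV3-NODE §116» 2026-09-01 00:13:02Z; px19 g25 01:09:19Z «(G7-T∕S)-lattice … say MINE and it is yours»; MINE 01:12:03Z).
Stage T of px19 g25's 8-colour gluing (§116.3) fills every SLICE of a class-110 block — a discrete square `{0..n}²` with prescribed data on its boundary ring — by CONING toward
a centre `a` (✓p839271 `…ConeFilling`: depth parameter `1 − k∕n′`, radial step `(π−r)∕n′`, tangential step `(1 − k∕n′)·Λ·dist1(q·q′⁻¹)`), reading the datum at the RADIAL
PROJECTION of the site to the boundary.  What the cone needs from the square is pure `ℕ` geometry: a depth with the right range and unit variation, a projection landing on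
the boundary and fixing it, and — the one real point — that lattice neighbours project to boundary points whose `ℓ¹` distance, MULTIPLIED BY the depth factor's numerator
`n′ − k`, stays `≤ n`: the proportional map from ring `k` (side `n − 2k`) to ring `0` (side `n`) expands by `≈ n∕(n−2k)` and the cone contracts by `(n∕2 − k)∕(n∕2)`.
The nearest-face projection would NOT do (it tears ring corners apart by `2k + 1`); the central scaling `t ↦ ⌊n(t−k)∕(n−2k)⌋` sends ring corners to corners EXACTLY, so its two
coordinate formulas agree there and no case analysis on sides is needed.  THIS FILE is that geometry; FILE T2 `…ConeOnSquare` reads it into ✓p839271.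

WHAT IS PROVED (sorry-free; `dep i j := min (min i j) (min (n − i) (n − j))`, `f k t := n·(t − k) ∕ (n − 2k)` (ℕ-division), `pr i j := (f (dep i j) i, f (dep i j) j)`, `n′ := n ∕ 2`).
§0 FLOOR ARITHMETIC: `mul_floor_step_le` (`m·(⌊n(u+1)∕m⌋ − ⌊nu∕m⌋) ≤ n + m`), `cross_floor_le_one`∕`_two` (`(m−2)·|⌊nu∕m⌋ − ⌊n(u−1)∕(m−2)⌋| ≤ 2n` for `1 ≤ u`, `u+1 ≤ m ≤ n`,
  `2 < m` — the two denominators of consecutive rings).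
§1 DEPTH: `dep_le_half`, `dep_eq_zero_iff` (`= 0 ↔` on the boundary), `dep_succ_le`∕`dep_le_succ` (unit variation along a bond), `dep_comm` (swap symmetry).
§2 PROJECTION: `f_self` (`f k k = 0`), `f_far` (`f k (n−k) = n` when `2k < n`), `f_le` (`≤ n`), `f_zero_depth` (`f 0 t = t`), `pr_mem_boundary`, `pr_eq_self_of_boundary`.
§3 ★★★ THE DISTORTION LAW `distortion_fst` ∕ `distortion_snd`: for lattice neighbours `x, y` in the square, `(n′ − max (dep x) (dep y)) * (Nat.dist (pr x).1 (pr y).1 + Nat.dist (pr x).2 (pr y).2) ≤ n`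
  (three cases: same depth — one coordinate moves by `⌊n(u+1)∕m⌋ − ⌊nu∕m⌋`, factor `≤ m∕2`; depth `k → k+1` — the moving site is on the side `i = k`, the other coordinate compares
  `⌊nu∕m⌋` with `⌊n(u−1)∕(m−2)⌋`, factor `≤ (m−2)∕2`; depth `k → k−1` — mirror, side `i = n − k`).
§4 ★★★ `exists_squareProjection (n) (hn : 2 ≤ n)` — the BINDER-STYLE EXPORT: `∃ dep pr`, defining equation of `dep` ∧ the six laws above (range, boundary landing, boundary identity,
  unit variation ×2, distortion ×2) — what FILE T2 consumes by `obtain`.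

DOMAIN SENTENCE (RULING №115 R5).  Pure `ℕ` geometry of one square; no group, no lattice `Params`, no blocks; the square's side `n ≥ 2` is the block side of §116.3 (`≥ ρ′ ≥ 1`,
in fact `≥ 8`-class), the identification with a slice of a class-110 block is (G6)∕(G8)'s binder bookkeeping (px19).

HONEST SCOPE.  Elementary; `hsupp⁺`∕`hBG` is a CONJECTURE with a plan (§116) and numerics (FL-39∕40), NOT proved; (G7-S)-lattice (the shell, one dimension up), (G8), the
assembly OPEN; nothing of Bałaban's renormalisation-group analysis asserted or proved ([Balaban1985RegularSpaces] (1.29) p.81 — the printed LOCAL gauges the road globalises);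
`hsupp^{≥J₀}`, hD, hDBX, h3 HYPOTHESES; GAP♯∘ (registry v11 3732b7df; v12.1 adopted-in-waiting), the five registered stubs (0∕5), S2β, 20520, 19936, 19200, `YM3TorusSU2`
NOT proved; no registered stub closed; rung R3 — NOT d = 4, NOT infinite volume, NOT a mass gap, NOT Clay; the Yang–Mills mass gap is NOT proved.
-/

set_option autoImplicit false

namespace Summit.QuantumFields.YangMills.Theorems.FluctuationComparisonRegPrIntLS2BetaSquareRadialProjection

/-! ## §0 Floor arithmetic for the proportional map -/

/-- Consecutive floors with the same denominator: `m·(⌊n(u+1)∕m⌋ − ⌊nu∕m⌋) ≤ n + m` (`0 < m`). [folklore] -/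
theorem mul_floor_step_le (n m u : ℕ) (hm : 0 < m) :
    m * (n * (u + 1) / m - n * u / m) ≤ n + m := by
  have h1 : m * (n * (u + 1) / m) ≤ n * (u + 1) := Nat.mul_div_le _ _
  have h2 : n * u < m * (n * u / m) + m := by
    have := Nat.lt_div_mul_add (a := n * u) hm
    rwa [Nat.mul_comm (n * u / m) m] at this
  rw [Nat.mul_sub]
  have h3 : m * (n * (u + 1) / m) ≤ m * (n * u / m) + (n + m) := by nlinarith
  omega

/-- Floors with the denominators `m` and `m − 2` of two consecutive rings, first direction: `(m−2)·(⌊nu∕m⌋ − ⌊n(u−1)∕(m−2)⌋) ≤ 2n` (`2 < m ≤ n`, `1 ≤ u`). [folklore] -/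
theorem cross_floor_le_one (n m u : ℕ) (hm : 2 < m) (hmn : m ≤ n) (hu1 : 1 ≤ u) :
    (m - 2) * (n * u / m - n * (u - 1) / (m - 2)) ≤ 2 * n := by
  have hm2 : 0 < m - 2 := by omega
  have hA1 : m * (n * u / m) ≤ n * u := Nat.mul_div_le _ _
  have hB2 : n * (u - 1) < (m - 2) * (n * (u - 1) / (m - 2)) + (m - 2) := by
    have := Nat.lt_div_mul_add (a := n * (u - 1)) hm2
    rwa [Nat.mul_comm (n * (u - 1) / (m - 2)) (m - 2)] at this
  rw [Nat.mul_sub]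
  have hu : n * (u - 1) = n * u - n := by rw [Nat.mul_sub, mul_one]
  have hnu : n ≤ n * u := Nat.le_mul_of_pos_right _ (by omega)
  have e1 : (m - 2) * (n * u / m) + 2 * (n * u / m) = m * (n * u / m) := by
    rw [← Nat.add_mul]; congr 1; omega
  have key : (m - 2) * (n * u / m) ≤ (m - 2) * (n * (u - 1) / (m - 2)) + 2 * n := by
    zify [hm.le, hu1, hnu] at *
    nlinarith
  omega

/-- Second direction: `(m−2)·(⌊n(u−1)∕(m−2)⌋ − ⌊nu∕m⌋) ≤ 2n` (`2 < m ≤ n`, `1 ≤ u`, `u + 1 ≤ m`). [folklore] -/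
theorem cross_floor_le_two (n m u : ℕ) (hm : 2 < m) (hmn : m ≤ n) (hu1 : 1 ≤ u) (hum : u + 1 ≤ m) :
    (m - 2) * (n * (u - 1) / (m - 2) - n * u / m) ≤ 2 * n := by
  have hm0 : 0 < m := by omega
  have hA2 : n * u < m * (n * u / m) + m := by
    have := Nat.lt_div_mul_add (a := n * u) hm0
    rwa [Nat.mul_comm (n * u / m) m] at this
  have hB1 : (m - 2) * (n * (u - 1) / (m - 2)) ≤ n * (u - 1) := Nat.mul_div_le _ _
  have hA1 : m * (n * u / m) ≤ n * u := Nat.mul_div_le _ _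
  rw [Nat.mul_sub]
  have hu : n * (u - 1) = n * u - n := by rw [Nat.mul_sub, mul_one]
  have hnu : n ≤ n * u := Nat.le_mul_of_pos_right _ (by omega)
  have hum' : n * u + n ≤ n * m := by nlinarith
  have e1 : (m - 2) * (n * u / m) + 2 * (n * u / m) = m * (n * u / m) := by
    rw [← Nat.add_mul]; congr 1; omega
  have key : (m - 2) * (n * (u - 1) / (m - 2)) ≤ (m - 2) * (n * u / m) + 2 * n := by
    zify [hm.le, hu1, hnu] at *
    nlinarith
  omega

/-! ## §1 The depth `min(i, j, n − i, n − j)` -/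

/-- In the square the depth is at most `n ∕ 2`. [folklore] -/
theorem dep_le_half (n i j : ℕ) (hi : i ≤ n) (hj : j ≤ n) : min (min i j) (min (n - i) (n - j)) ≤ n / 2 := by
  omega

/-- Depth `0` is the boundary ring. [folklore] -/
theorem dep_eq_zero_iff (n i j : ℕ) (hi : i ≤ n) (hj : j ≤ n) :
    min (min i j) (min (n - i) (n - j)) = 0 ↔ (i = 0 ∨ i = n ∨ j = 0 ∨ j = n) := by
  omega

/-- Along a horizontal bond the depth changes by at most one. [folklore] -/
theorem dep_succ_le (n i j : ℕ) : min (min (i + 1) j) (min (n - (i + 1)) (n - j)) ≤ min (min i j) (min (n - i) (n - j)) + 1 := by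
  omega

/-- Along a horizontal bond the depth changes by at most one (other direction). [folklore] -/
theorem dep_le_succ (n i j : ℕ) : min (min i j) (min (n - i) (n - j)) ≤ min (min (i + 1) j) (min (n - (i + 1)) (n - j)) + 1 := by
  omega

/-- The depth is symmetric in the two coordinates. [folklore] -/
theorem dep_comm (n i j : ℕ) : min (min j i) (min (n - j) (n - i)) = min (min i j) (min (n - i) (n - j)) := by
  rw [min_comm j i, min_comm (n - j) (n - i)]

/-! ## §2 The proportional projection `f k t = ⌊n(t − k)∕(n − 2k)⌋` -/

/-- The near corner goes to the near corner: `f k k = 0`. [folklore] -/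
theorem f_self (n k : ℕ) : n * (k - k) / (n - 2 * k) = 0 := by
  simp

/-- The far corner goes to the far corner: `f k (n − k) = n` when `2k < n`. [folklore] -/
theorem f_far (n k : ℕ) (hk : 2 * k < n) : n * ((n - k) - k) / (n - 2 * k) = n := by
  have hm : 0 < n - 2 * k := by omega
  rw [show n - k - k = n - 2 * k by omega, Nat.mul_div_cancel _ hm]

/-- The projection coordinate is at most `n` on the ring's range `k ≤ t ≤ n − k`. [folklore] -/
theorem f_le (n k t : ℕ) (hkt : k ≤ t) (htk : t ≤ n - k) : n * (t - k) / (n - 2 * k) ≤ n := by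
  rcases Nat.eq_zero_or_pos (n - 2 * k) with h0 | hm
  · rw [h0, Nat.div_zero]; exact Nat.zero_le _
  · refine (Nat.div_le_div_right (c := n - 2 * k) (Nat.mul_le_mul_left n (show t - k ≤ n - 2 * k by omega))).trans ?_
    rw [Nat.mul_div_cancel _ hm]

/-- On the boundary ring (`k = 0`) the projection is the identity: `f 0 t = t` (`0 < n`). [folklore] -/
theorem f_zero_depth (n t : ℕ) (hn : 0 < n) : n * (t - 0) / (n - 2 * 0) = t := by
  rw [Nat.sub_zero, Nat.mul_zero, Nat.sub_zero, Nat.mul_div_cancel_left _ hn]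

/-- ★ **THE PROJECTION LANDS ON THE BOUNDARY RING**: for a site of the square, one projected coordinate is `0` or `n` and both are `≤ n` (at depth `k` one of `i, j, n−i, n−j`
equals `k`, whose coordinate maps to `0` or `n`; at the centre `n − 2k = 0` and the projection is `(0, 0)` by ℕ-division). [folklore] -/
theorem pr_mem_boundary (n i j : ℕ) (hi : i ≤ n) (hj : j ≤ n) :
    (n * (i - min (min i j) (min (n - i) (n - j))) / (n - 2 * min (min i j) (min (n - i) (n - j))) = 0 ∨
      n * (i - min (min i j) (min (n - i) (n - j))) / (n - 2 * min (min i j) (min (n - i) (n - j))) = n ∨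
      n * (j - min (min i j) (min (n - i) (n - j))) / (n - 2 * min (min i j) (min (n - i) (n - j))) = 0 ∨
      n * (j - min (min i j) (min (n - i) (n - j))) / (n - 2 * min (min i j) (min (n - i) (n - j))) = n) ∧
    n * (i - min (min i j) (min (n - i) (n - j))) / (n - 2 * min (min i j) (min (n - i) (n - j))) ≤ n ∧
    n * (j - min (min i j) (min (n - i) (n - j))) / (n - 2 * min (min i j) (min (n - i) (n - j))) ≤ n := by
  set k := min (min i j) (min (n - i) (n - j)) with hk
  have hki : k ≤ i := by omega
  have hkj : k ≤ j := by omega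
  have hik : i ≤ n - k := by omega
  have hjk : j ≤ n - k := by omega
  refine ⟨?_, f_le n k i hki hik, f_le n k j hkj hjk⟩
  rcases Nat.eq_zero_or_pos (n - 2 * k) with h0 | hm
  · left; rw [h0, Nat.div_zero]
  · have hk2 : 2 * k < n := by omega
    -- one of the four coordinates realises the minimum
    have hcases : i = k ∨ i = n - k ∨ j = k ∨ j = n - k := by omega
    rcases hcases with h | h | h | h
    · left; rw [h, f_self]
    · right; left; rw [h, f_far n k hk2]
    · right; right; left; rw [h, f_self]
    · right; right; right; rw [h, f_far n k hk2]

/-- ★ **THE PROJECTION FIXES THE BOUNDARY**: at depth `0` both coordinates are returned unchanged (`0 < n`). [folklore] -/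
theorem pr_eq_self_of_boundary (n i j : ℕ) (hn : 0 < n) (hi : i ≤ n) (hj : j ≤ n) (hb : i = 0 ∨ i = n ∨ j = 0 ∨ j = n) :
    n * (i - min (min i j) (min (n - i) (n - j))) / (n - 2 * min (min i j) (min (n - i) (n - j))) = i ∧
    n * (j - min (min i j) (min (n - i) (n - j))) / (n - 2 * min (min i j) (min (n - i) (n - j))) = j := by
  have hk : min (min i j) (min (n - i) (n - j)) = 0 := (dep_eq_zero_iff n i j hi hj).2 hb
  rw [hk]
  exact ⟨f_zero_depth n i hn, f_zero_depth n j hn⟩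

/-! ## §3 The distortion law -/

/-- From `c·D ≤ 2n` and `2a ≤ c` conclude `a·D ≤ n` (the depth factor's numerator against the ring side). [folklore] -/
theorem mul_le_of_two_mul_le {a c D n : ℕ} (hac : 2 * a ≤ c) (hcD : c * D ≤ 2 * n) : a * D ≤ n := by
  have h : 2 * (a * D) ≤ 2 * n :=
    calc 2 * (a * D) = (2 * a) * D := by ring
      _ ≤ c * D := Nat.mul_le_mul_right _ hac
      _ ≤ 2 * n := hcD
  omega

/-- ★★★ **THE DISTORTION LAW ALONG A HORIZONTAL BOND**: for `x = (i, j)`, `y = (i+1, j)` in the square,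
`(n∕2 − max (dep x) (dep y)) · (|Δ pr₁| + |Δ pr₂|) ≤ n`. [folklore] -/
theorem distortion_fst (n i j : ℕ) (hi : i + 1 ≤ n) (hj : j ≤ n) :
    (n / 2 - max (min (min i j) (min (n - i) (n - j))) (min (min (i + 1) j) (min (n - (i + 1)) (n - j)))) *
      (Nat.dist (n * (i - min (min i j) (min (n - i) (n - j))) / (n - 2 * min (min i j) (min (n - i) (n - j))))
          (n * ((i + 1) - min (min (i + 1) j) (min (n - (i + 1)) (n - j))) / (n - 2 * min (min (i + 1) j) (min (n - (i + 1)) (n - j)))) +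
        Nat.dist (n * (j - min (min i j) (min (n - i) (n - j))) / (n - 2 * min (min i j) (min (n - i) (n - j))))
          (n * (j - min (min (i + 1) j) (min (n - (i + 1)) (n - j))) / (n - 2 * min (min (i + 1) j) (min (n - (i + 1)) (n - j))))) ≤ n := by
  set kx := min (min i j) (min (n - i) (n - j)) with hkx
  set ky := min (min (i + 1) j) (min (n - (i + 1)) (n - j)) with hky
  by_cases hfac : n / 2 - max kx ky = 0
  · rw [hfac, zero_mul]; exact Nat.zero_le _
  have hkx2 : kx < n / 2 := by omega
  have hky2 : ky < n / 2 := by omega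
  have hcases : ky = kx ∨ ky = kx + 1 ∨ kx = ky + 1 := by omega
  rcases hcases with h | h | h
  · -- same depth `k`: the second coordinates agree, the first move by one proportional step
    have hk_i : kx ≤ i := by omega
    have hm : 0 < n - 2 * kx := by omega
    rw [h, max_self, Nat.dist_self, add_zero]
    have hmono : n * (i - kx) / (n - 2 * kx) ≤ n * (i + 1 - kx) / (n - 2 * kx) :=
      Nat.div_le_div_right (Nat.mul_le_mul_left n (by omega))
    rw [Nat.dist_eq_sub_of_le hmono, show i + 1 - kx = (i - kx) + 1 by omega]
    have hstep := mul_floor_step_le n (n - 2 * kx) (i - kx) hm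
    exact mul_le_of_two_mul_le (c := n - 2 * kx) (by omega) (by omega)
  · -- depth `k → k+1`: `x` sits on the side `i = k`; only the second coordinate moves, across the two denominators
    have hik : i = kx := by omega
    have hm3 : 2 < n - 2 * kx := by omega
    have hu1 : 1 ≤ j - kx := by omega
    have hum : j - kx + 1 ≤ n - 2 * kx := by omega
    rw [h, max_eq_right (Nat.le_succ _)]
    have h1x : n * (i - kx) / (n - 2 * kx) = 0 := by rw [hik, Nat.sub_self, mul_zero, Nat.zero_div]
    have h1y : n * (i + 1 - (kx + 1)) / (n - 2 * (kx + 1)) = 0 := by rw [hik, Nat.sub_self, mul_zero, Nat.zero_div]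
    rw [h1x, h1y, Nat.dist_self, zero_add]
    have hden : n - 2 * (kx + 1) = n - 2 * kx - 2 := by omega
    have hnum : j - (kx + 1) = j - kx - 1 := by omega
    rw [hden, hnum]
    have hA := cross_floor_le_one n (n - 2 * kx) (j - kx) hm3 (by omega) hu1
    have hB := cross_floor_le_two n (n - 2 * kx) (j - kx) hm3 (by omega) hu1 hum
    rcases le_total (n * (j - kx) / (n - 2 * kx)) (n * (j - kx - 1) / (n - 2 * kx - 2)) with hle | hle
    · rw [Nat.dist_eq_sub_of_le hle]
      exact mul_le_of_two_mul_le (c := n - 2 * kx - 2) (by omega) hB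
    · rw [Nat.dist_eq_sub_of_le_right hle]
      exact mul_le_of_two_mul_le (c := n - 2 * kx - 2) (by omega) hA
  · -- depth `k+1 → k` (`x` deeper): `x` sits on the side `i = n − (k+1)`; mirror of the previous case, SAME two denominators with the roles of `x`, `y` swapped
    have hik : i = n - (ky + 1) := by omega
    have hm3 : 2 < n - 2 * ky := by omega
    have hu1 : 1 ≤ j - ky := by omega
    have hum : j - ky + 1 ≤ n - 2 * ky := by omega
    rw [h, max_eq_left (Nat.le_succ _)]
    have hmx : 0 < n - 2 * (ky + 1) := by omega
    have hmy : 0 < n - 2 * ky := by omega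
    have h1x : n * (i - (ky + 1)) / (n - 2 * (ky + 1)) = n := by
      rw [show i - (ky + 1) = n - 2 * (ky + 1) by omega, Nat.mul_div_cancel _ hmx]
    have h1y : n * (i + 1 - ky) / (n - 2 * ky) = n := by
      rw [show i + 1 - ky = n - 2 * ky by omega, Nat.mul_div_cancel _ hmy]
    rw [h1x, h1y, Nat.dist_self, zero_add]
    have hden : n - 2 * (ky + 1) = n - 2 * ky - 2 := by omega
    have hnum : j - (ky + 1) = j - ky - 1 := by omega
    rw [hden, hnum]
    have hA := cross_floor_le_one n (n - 2 * ky) (j - ky) hm3 (by omega) hu1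
    have hB := cross_floor_le_two n (n - 2 * ky) (j - ky) hm3 (by omega) hu1 hum
    rcases le_total (n * (j - ky - 1) / (n - 2 * ky - 2)) (n * (j - ky) / (n - 2 * ky)) with hle | hle
    · rw [Nat.dist_eq_sub_of_le hle]
      exact mul_le_of_two_mul_le (c := n - 2 * ky - 2) (by omega) hA
    · rw [Nat.dist_eq_sub_of_le_right hle]
      exact mul_le_of_two_mul_le (c := n - 2 * ky - 2) (by omega) hB

/-- ★★★ **THE DISTORTION LAW ALONG A VERTICAL BOND** (`x = (i, j)`, `y = (i, j+1)`), by the swap symmetry of depth and projection. [folklore] -/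
theorem distortion_snd (n i j : ℕ) (hi : i ≤ n) (hj : j + 1 ≤ n) :
    (n / 2 - max (min (min i j) (min (n - i) (n - j))) (min (min i (j + 1)) (min (n - i) (n - (j + 1))))) *
      (Nat.dist (n * (i - min (min i j) (min (n - i) (n - j))) / (n - 2 * min (min i j) (min (n - i) (n - j))))
          (n * (i - min (min i (j + 1)) (min (n - i) (n - (j + 1)))) / (n - 2 * min (min i (j + 1)) (min (n - i) (n - (j + 1))))) +
        Nat.dist (n * (j - min (min i j) (min (n - i) (n - j))) / (n - 2 * min (min i j) (min (n - i) (n - j))))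
          (n * ((j + 1) - min (min i (j + 1)) (min (n - i) (n - (j + 1)))) / (n - 2 * min (min i (j + 1)) (min (n - i) (n - (j + 1)))))) ≤ n := by
  have h := distortion_fst n j i hj hi
  rw [dep_comm n i j, dep_comm n i (j + 1)] at h
  rwa [add_comm (Nat.dist _ _)] at h

/-! ## §4 The binder-style export -/

/-- ★★★ **THE PROPORTIONAL RADIAL PROJECTION OF THE DISCRETE SQUARE** (binder style): for `n ≥ 2` there are a depth `dep` and a projection `pr` on `ℕ × ℕ` with — on the
square `i, j ≤ n` — `dep` = `min(i, j, n−i, n−j)` (so `≤ n∕2`, `= 0` exactly on the boundary, unit variation along bonds), `pr` landing on the boundary ring and fixing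
it, and THE DISTORTION LAW `(n∕2 − max depth)·|Δ pr|₁ ≤ n` along every horizontal and vertical bond. [folklore] -/
theorem exists_squareProjection (n : ℕ) (hn : 2 ≤ n) :
    ∃ (dep : ℕ → ℕ → ℕ) (pr : ℕ → ℕ → ℕ × ℕ),
      (∀ i j, dep i j = min (min i j) (min (n - i) (n - j))) ∧
      (∀ i j, i ≤ n → j ≤ n → dep i j ≤ n / 2) ∧
      (∀ i j, i ≤ n → j ≤ n → (dep i j = 0 ↔ (i = 0 ∨ i = n ∨ j = 0 ∨ j = n))) ∧
      (∀ i j, i ≤ n → j ≤ n →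
        ((pr i j).1 = 0 ∨ (pr i j).1 = n ∨ (pr i j).2 = 0 ∨ (pr i j).2 = n) ∧ (pr i j).1 ≤ n ∧ (pr i j).2 ≤ n) ∧
      (∀ i j, i ≤ n → j ≤ n → (i = 0 ∨ i = n ∨ j = 0 ∨ j = n) → pr i j = (i, j)) ∧
      (∀ i j, dep (i + 1) j ≤ dep i j + 1 ∧ dep i j ≤ dep (i + 1) j + 1) ∧
      (∀ i j, dep i (j + 1) ≤ dep i j + 1 ∧ dep i j ≤ dep i (j + 1) + 1) ∧
      (∀ i j, i + 1 ≤ n → j ≤ n →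
        (n / 2 - max (dep i j) (dep (i + 1) j)) * (Nat.dist (pr i j).1 (pr (i + 1) j).1 + Nat.dist (pr i j).2 (pr (i + 1) j).2) ≤ n) ∧
      (∀ i j, i ≤ n → j + 1 ≤ n →
        (n / 2 - max (dep i j) (dep i (j + 1))) * (Nat.dist (pr i j).1 (pr i (j + 1)).1 + Nat.dist (pr i j).2 (pr i (j + 1)).2) ≤ n) := by
  have hn0 : 0 < n := by omega
  refine ⟨fun i j => min (min i j) (min (n - i) (n - j)),
    fun i j => (n * (i - min (min i j) (min (n - i) (n - j))) / (n - 2 * min (min i j) (min (n - i) (n - j))),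
      n * (j - min (min i j) (min (n - i) (n - j))) / (n - 2 * min (min i j) (min (n - i) (n - j)))),
    fun _ _ => rfl, fun i j hi hj => dep_le_half n i j hi hj, fun i j hi hj => dep_eq_zero_iff n i j hi hj,
    fun i j hi hj => pr_mem_boundary n i j hi hj, fun i j hi hj hb => ?_,
    fun i j => ⟨dep_succ_le n i j, dep_le_succ n i j⟩, fun i j => ?_,
    fun i j hi hj => distortion_fst n i j hi hj, fun i j hi hj => distortion_snd n i j hi hj⟩
  · obtain ⟨h1, h2⟩ := pr_eq_self_of_boundary n i j hn0 hi hj hb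
    exact Prod.ext h1 h2
  · have h1 := dep_succ_le n j i
    have h2 := dep_le_succ n j i
    rw [dep_comm n i j, dep_comm n i (j + 1)] at h1 h2
    exact ⟨h1, h2⟩

end Summit.QuantumFields.YangMills.Theorems.FluctuationComparisonRegPrIntLS2BetaSquareRadialProjection
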